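import Summits.SmoothPoincare4.SmoothPoincare4.Theorems.CylinderEntropyImmortalAreaToFloorFlowInputs
import HarnessLib

/-!
# Route `CylinderEntropy`, crux `CylinderRungTwo` (stmt-SmoothPoincare4-7631), line `killing-flux`:
# area-floor forms of the two upper Gaussian density bounds
# (registered helpers `helper_upperDensityAllScalesOfFloor` and
# `helper_upperGaussianDensityLateOfFloor`; lead c7, wave 3)

Along a smooth mean curvature flow `IsCylinderMCF M F ν T` of closed embedded cross-sections of
`N = S⁴ × ℝ ⊂ ℝ⁶`, write `vol = μH⁴(S⁴)`, `M_t = range (F t)`, `A(t) = μH⁴(M_t)` and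
`A_∞ = ⨅_{t ≥ T} A(t)`.  The two landed bounds

* `helper_upperDensityAllScales` — `F̂_{p,τ}(M_s) ≤ (1 + ε) · A_∞ / vol` for all late `s`, all centres
  `p ∈ N` and ALL scales `τ > 0` (Hamilton's monotonicity with a large lag plus the large-scale
  kernel tail bound), and
* `upperGaussianDensity_late` — `∫_M G_τ(F_s - p) dμ_s ≤ 2 - δ₀` for all late `s`, `p ∈ N`,
  `0 < τ ≤ τ_max`, along flows of entropy `< 2`,

use the hypothesis "every slice separates the ends of `N`" ONLY through the area floor `vol ≤ A(t)`
of separating slices.  Here the same two statements are proved with the separation hypothesis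
REPLACED by the area floor `∀ t ≥ T, vol ≤ μH⁴(M_t)` itself (along the null-survivor branch of the
line this floor comes from the parabolic area floor, not from separation).  The proofs are those of
the separating versions with the single floor step swapped.

Everything here is PROVED (no `sorry`, no definitions, no named facts).

References: R. S. Hamilton, *Monotonicity formulas for parabolic flows on manifolds*, Comm. Anal.
Geom. 1 (1993) 127–137, Thm. 4.1; T. H. Colding, W. P. Minicozzi II, Ann. of Math. 175 (2012).
-/

-- the prescribed namespace `Summit.SmoothPoincare4.SmoothPoincare4.…` repeats `SmoothPoincare4`
set_option linter.dupNamespace false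

noncomputable section

open Bundle Set Function Filter MeasureTheory Module
open scoped Manifold ContDiff Topology RealInnerProductSpace BigOperators ENNReal NNReal

namespace Summit.SmoothPoincare4.SmoothPoincare4.Cruxes.CylinderRungTwo.KillingFlux

open Literature.Geometry.Riemannian Literature.Geometry.Riemannian.EuclideanHypersurface
open Literature.Geometry.Lorentzian Literature.Geometry.Lorentzian.PseudoRiemannianMetric
open Literature.Geometry.Riemannian.SphericalCylinderEntropy (cylEntropy cylDensity tail
  measure_ratio_le_cylEntropy hausdorffMeasure_sphere_four_pos hausdorffMeasure_sphere_four_lt_top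
  hausdorffMeasure_range_lt_top_of_isSpacelikeImmersion)

/-- **Registered helper `helper_upperDensityAllScalesOfFloor`: upper Gaussian density bound at ALL
scales and all centres for large times, area-floor form of `helper_upperDensityAllScales`
(separation replaced by the floor hypothesis `∀ t ≥ T, μH⁴(S⁴) ≤ μH⁴(M_t)`).**  Along a smooth mean
curvature flow `IsCylinderMCF M F ν T` of closed embedded cross-sections of `N = S⁴ × ℝ` whose
slices have area at least `μH⁴(S⁴)`, for every `ε > 0` there is `s₀ ≥ T` with
`F̂_{p,τ}(M_s) ≤ (1+ε) · (⨅_{t ≥ T} μH⁴(M_t)) / μH⁴(S⁴)` for all `s ≥ s₀`, `p ∈ N`, `τ > 0`: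
Hamilton's monotonicity with a large lag plus the large-scale kernel tail bound, at a base time
whose area is within `1 + δ` of the infimum of the areas. [cite: Hamilton1993, §4] -/
theorem helper_upperDensityAllScalesOfFloor : ∀ (M : Type) [TopologicalSpace M] [T2Space M] [SecondCountableTopology M] [ChartedSpace (EuclideanSpace ℝ (Fin 4)) M] [IsManifold (𝓡 4) ∞ M] [CompactSpace M] [MeasurableSpace M] [BorelSpace M] (F : ℝ → M → EuclideanSpace ℝ (Fin 6)) (ν : ℝ → M → EuclideanSpace ℝ (Fin 6)) (T : ℝ), IsCylinderMCF M F ν T → (∀ t, T ≤ t → μH[4] (Metric.sphere (0 : EuclideanSpace ℝ (Fin 5)) 1) ≤ μH[4] (Set.range (F t))) → ∀ ε : ℝ, 0 < ε → ∃ s₀ : ℝ, T ≤ s₀ ∧ ∀ s, s₀ ≤ s → ∀ p : EuclideanSpace ℝ (Fin 6), ∑ i : Fin 5, p (Fin.castSucc i) ^ 2 = 1 → ∀ τ : ℝ, 0 < τ → cylDensity (Set.range (F s)) p τ ≤ ENNReal.ofReal (1 + ε) * ((μH[4] (Metric.sphere (0 : EuclideanSpace ℝ (Fin 5)) 1))⁻¹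 * ⨅ t : Set.Ici T, μH[4] (Set.range (F t))) := by
  intro M _ _ _ _ _ _ _ _ F ν T hF hfl ε hε
  -- the slack
  set δ : ℝ := min ε 1 / 3 with hδ
  have hδpos : 0 < δ := by rw [hδ]; exact div_pos (lt_min hε one_pos) (by norm_num)
  have hδ3 : δ ≤ 1 / 3 := by
    rw [hδ]; exact div_le_div_of_nonneg_right (min_le_right ε 1) (by norm_num)
  have hδε : 3 * δ ≤ ε := by
    rw [hδ]; linarith [min_le_left ε 1]
  -- the infimum of the areas is neither `0` (area floor hypothesis) nor `⊤`
  set Ainf : ℝ≥0∞ := ⨅ t : Set.Ici T, μH[4] (Set.range (F t)) with hAinf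
  have hvol0 : μH[4] (Metric.sphere (0 : (EuclideanSpace ℝ (Fin 5))) 1) ≠ 0 :=
    hausdorffMeasure_sphere_four_pos.ne'
  have hfloor : μH[4] (Metric.sphere (0 : (EuclideanSpace ℝ (Fin 5))) 1) ≤ Ainf :=
    le_iInf fun t => hfl t t.2
  have hA0 : Ainf ≠ 0 := fun h => hvol0 (le_zero_iff.1 (h ▸ hfloor))
  have hAtop : Ainf ≠ ⊤ := by
    refine ne_top_of_le_ne_top ?_
      (iInf_le (fun t : Set.Ici T => μH[4] (Set.range (F t))) ⟨T, Set.self_mem_Ici⟩)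
    exact (hausdorffMeasure_range_lt_top_of_isSpacelikeImmersion
      (hF.isSpacelikeImmersion T le_rfl) (hF.injective le_rfl)).ne
  -- a time where the area is within `1+δ` of the infimum
  obtain ⟨t₁, hTt₁, harea⟩ : ∃ t₁ : ℝ, T ≤ t₁ ∧
      μH[4] (Set.range (F t₁)) < ENNReal.ofReal (1 + δ) * Ainf := by
    have hlt : Ainf < ENNReal.ofReal (1 + δ) * Ainf := by
      conv_lhs => rw [← one_mul Ainf]
      exact ENNReal.mul_lt_mul_left hA0 hAtop (ENNReal.one_lt_ofReal.2 (by linarith))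
    rw [hAinf] at hlt
    obtain ⟨⟨t₁, ht₁⟩, h⟩ := iInf_lt_iff.1 hlt
    exact ⟨t₁, ht₁, h⟩
  -- a lag beyond which the kernel tail is below `δ`
  obtain ⟨σ₀, hσ₀1, hσ₀⟩ : ∃ σ₀ : ℝ, 1 ≤ σ₀ ∧ tail σ₀ < δ :=
    ((Filter.eventually_ge_atTop 1).and
      ((tendsto_order.1 tendsto_tail_atTop).2 δ hδpos)).exists
  refine ⟨t₁ + σ₀, by linarith, fun s hs p hp τ hτ => ?_⟩
  have hσ : 0 ≤ s - t₁ := by linarith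
  have h1 := hF.cylDensity_le hp (s := t₁) (σ := s - t₁) hTt₁ hσ hτ
  rw [show t₁ + (s - t₁) = s by ring] at h1
  have hτ' : 1 ≤ τ + (s - t₁) := by linarith
  have h2 := cylDensity_le_one_add_tail_mul (A := Set.range (F t₁))
    (by rintro z ⟨x, rfl⟩; exact hF.mem_cyl t₁ hTt₁ x) hp hτ'
  have h3 : tail (τ + (s - t₁)) ≤ δ :=
    ((tail_le_tail (by linarith) (by linarith : σ₀ ≤ τ + (s - t₁))).trans hσ₀.le)
  have hsq : (1 + δ) * (1 + δ) ≤ 1 + ε := by nlinarith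
  calc cylDensity (Set.range (F s)) p τ
      ≤ cylDensity (Set.range (F t₁)) p (τ + (s - t₁)) := h1
    _ ≤ ENNReal.ofReal (1 + tail (τ + (s - t₁))) *
          ((μH[4] (Metric.sphere (0 : (EuclideanSpace ℝ (Fin 5))) 1))⁻¹ *
            μH[4] (Set.range (F t₁))) := h2
    _ ≤ ENNReal.ofReal (1 + δ) *
          ((μH[4] (Metric.sphere (0 : (EuclideanSpace ℝ (Fin 5))) 1))⁻¹ *
            (ENNReal.ofReal (1 + δ) * Ainf)) := by
        gcongr
    _ = ENNReal.ofReal ((1 + δ) * (1 + δ)) *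
          ((μH[4] (Metric.sphere (0 : (EuclideanSpace ℝ (Fin 5))) 1))⁻¹ * Ainf) := by
        rw [ENNReal.ofReal_mul (by linarith)]
        ring
    _ ≤ ENNReal.ofReal (1 + ε) *
          ((μH[4] (Metric.sphere (0 : (EuclideanSpace ℝ (Fin 5))) 1))⁻¹ * Ainf) := by
        gcongr

/-- **Registered helper `helper_upperGaussianDensityLateOfFloor`: uniform upper Gaussian density
bound at late times (entropy `< 2`), area-floor form of `upperGaussianDensity_late` (separation
replaced by the floor hypothesis `∀ t ≥ T, μH⁴(S⁴) ≤ μH⁴(M_t)`).**  Along a cylinder flow whose slices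
have area at least `μH⁴(S⁴)` and entropy `< 2` there are `δ₀ ∈ (0, 1/2]`, `τ_max > 0` and `s₀ ≥ T`
such that for all `s ≥ s₀` (`s ≥ T`), `p ∈ N`, `0 < τ ≤ τ_max`:
`∫_M exp(-‖F s w - p‖²/(4τ))/(4πτ)² dμ_s(w) ≤ 2 - δ₀` (uniform entropy gap, the density-level
Cheeger–Yau domination `helper_gaussianAreaLeCylDensity`, and `helper_upperDensityAllScalesOfFloor`).
[cite: Hamilton1993, §4] -/
theorem helper_upperGaussianDensityLateOfFloor : ∀ (M : Type) [TopologicalSpace M] [T2Space M] [SecondCountableTopology M] [ChartedSpace (EuclideanSpace ℝ (Fin 4)) M] [IsManifold (𝓡 4) ∞ M] [CompactSpace M] [MeasurableSpace M] [BorelSpace M] (F : ℝ → M → EuclideanSpace ℝ (Fin 6)) (ν : ℝ → M → EuclideanSpace ℝ (Fin 6)) (T : ℝ) (hF : IsCylinderMCF M F ν T), (∀ t, T ≤ t → μH[4] (Metric.sphere (0 : EuclideanSpace ℝ (Fin 5)) 1) ≤ μH[4] (Set.range (F t))) → (∀ t, T ≤ t → cylEntropy (Set.range (F t)) < 2) →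 ∃ δ₀ : ℝ, 0 < δ₀ ∧ δ₀ ≤ 1 / 2 ∧ ∃ τmax : ℝ, 0 < τmax ∧ ∃ s₀ : ℝ, T ≤ s₀ ∧ ∀ s (hsT : T ≤ s), s₀ ≤ s → ∀ p : EuclideanSpace ℝ (Fin 6), ∑ i : Fin 5, p (Fin.castSucc i) ^ 2 = 1 → ∀ τ, 0 < τ → τ ≤ τmax → ∫ w, Real.exp (-‖F s w - p‖ ^ 2 / (4 * τ)) / (4 * Real.pi * τ) ^ 2 ∂riemannianMeasure ((euclideanMetric (EuclideanSpace ℝ (Fin 6))).inducedRiemannianMetric (F s) contMDiff_pullbackBilin_holds (hF.isSpacelikeImmersion s hsT)) ≤ 2 - δ₀ := by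
  intro M _ _ _ _ _ _ _ _ F ν T hF hfl hthin
  -- the entropy gap
  obtain ⟨δ, hδ, hent⟩ := hF.exists_cylEntropy_le_ofReal_two_sub (hthin T le_rfl)
  set δ₁ : ℝ := min δ 1 with hδ₁
  have hδ₁0 : 0 < δ₁ := lt_min hδ one_pos
  have hδ₁1 : δ₁ ≤ 1 := min_le_right _ _
  have hδ₁δ : δ₁ ≤ δ := min_le_left _ _
  have h16 : 0 < δ₁ / 16 := by positivity
  have h16' : δ₁ / 16 ≤ 1 := by linarith
  -- kernel domination and Hamilton's bound, both with slack `δ₁/16`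
  obtain ⟨κ, hκ0, -, t₁, ht₁, hdom⟩ := helper_gaussianAreaLeCylDensity (δ₁ / 16) h16 h16'
  obtain ⟨s₀, hs₀T, hF2⟩ := helper_upperDensityAllScalesOfFloor M F ν T hF hfl (δ₁ / 16) h16
  refine ⟨δ₁ / 4, by positivity, by linarith, t₁, ht₁, s₀, hs₀T, fun s hsT hs p hp τ hτ hτle => ?_⟩
  set A : Set (EuclideanSpace ℝ (Fin 6)) := Set.range (F s) with hA
  have hcpt : IsCompact A := hF.isCompact_range hsT
  have hAm : MeasurableSet A := hcpt.isClosed.measurableSet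
  have hAN : ∀ z ∈ A, ∑ i : Fin 5, z (Fin.castSucc i) ^ 2 = 1 := by
    rintro z ⟨x, rfl⟩; exact hF.mem_cyl s hsT x
  -- the three atoms
  have h1 := hdom A hAN hAm p hp τ hτ hτle
  have h2 := hF2 s hs p hp ((1 + κ) * τ) (by positivity)
  have hinf : (μH[4] (Metric.sphere (0 : EuclideanSpace ℝ (Fin 5)) 1))⁻¹ *
      (⨅ t : Set.Ici T, μH[4] (Set.range (F t))) ≤ ENNReal.ofReal (2 - δ₁) := by
    calc (μH[4] (Metric.sphere (0 : EuclideanSpace ℝ (Fin 5)) 1))⁻¹ * (⨅ t : Set.Ici T, μH[4] (Set.range (F t)))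
        ≤ (μH[4] (Metric.sphere (0 : EuclideanSpace ℝ (Fin 5)) 1))⁻¹ * μH[4] (Set.range (F T)) := by
          gcongr
          exact iInf_le (fun t : Set.Ici T => μH[4] (Set.range (F t))) ⟨T, Set.self_mem_Ici⟩
      _ ≤ cylEntropy (Set.range (F T)) := hF.ratio_le_cylEntropy le_rfl
      _ ≤ ENNReal.ofReal (2 - δ) := hent T le_rfl
      _ ≤ ENNReal.ofReal (2 - δ₁) := ENNReal.ofReal_le_ofReal (by linarith)
  have hratio : (μH[4] (Metric.sphere (0 : EuclideanSpace ℝ (Fin 5)) 1))⁻¹ * μH[4] A ≤ 2 := by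
    calc (μH[4] (Metric.sphere (0 : EuclideanSpace ℝ (Fin 5)) 1))⁻¹ * μH[4] A ≤ cylEntropy A :=
          hF.ratio_le_cylEntropy hsT
      _ ≤ 2 := (hthin s hsT).le
  -- assemble in `ℝ≥0∞`
  have hG : gaussianArea 4 p τ A ≤ ENNReal.ofReal ((1 + δ₁ / 16) * ((1 + δ₁ / 16) * (2 - δ₁)) + δ₁ / 16 * 2) := by
    have hx : 0 ≤ 2 - δ₁ := by linarith
    calc gaussianArea 4 p τ A
        ≤ ENNReal.ofReal (1 + δ₁ / 16) * cylDensity A p ((1 + κ) * τ) +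
            ENNReal.ofReal (δ₁ / 16) * ((μH[4] (Metric.sphere (0 : EuclideanSpace ℝ (Fin 5)) 1))⁻¹ * μH[4] A) := h1
      _ ≤ ENNReal.ofReal (1 + δ₁ / 16) * (ENNReal.ofReal (1 + δ₁ / 16) * ENNReal.ofReal (2 - δ₁)) +
            ENNReal.ofReal (δ₁ / 16) * 2 := by
          gcongr
          exact h2.trans (mul_le_mul' le_rfl hinf)
      _ = ENNReal.ofReal ((1 + δ₁ / 16) * ((1 + δ₁ / 16) * (2 - δ₁)) + δ₁ / 16 * 2) := by
          rw [← ENNReal.ofReal_mul (by positivity), ← ENNReal.ofReal_mul (by positivity),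
            ← ENNReal.ofReal_ofNat 2, ← ENNReal.ofReal_mul (by positivity),
            ← ENNReal.ofReal_add (by positivity) (by positivity)]
  have harith := upperDensity_arith hδ₁0.le
  have hG' : gaussianArea 4 p τ A ≤ ENNReal.ofReal (2 - δ₁ / 4) :=
    hG.trans (ENNReal.ofReal_le_ofReal harith)
  rw [hA, gaussianArea_range_eq_ofReal_integral (hF.isSpacelikeImmersion s hsT) (hF.injective hsT) p hτ]
    at hG'
  exact (ENNReal.ofReal_le_ofReal_iff (by linarith)).1 hG'

end Summit.SmoothPoincare4.SmoothPoincare4.Cruxes.CylinderRungTwo.KillingFlux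

end
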